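import Summits.CriticalPhenomena.PercolationContinuityZ3.Theorems.Transplant.KNCells2ExitO
import Summits.CriticalPhenomena.PercolationContinuityZ3.Theorems.Transplant.KNCells2Exit
import Summits.CriticalPhenomena.PercolationContinuityZ3.Theorems.Transplant.SamePThetaPosOfOLawful
import Summits.CriticalPhenomena.PercolationContinuityZ3.Theorems.Transplant.SamePThetaPosOfLawful
import Summits.CriticalPhenomena.PercolationContinuityZ3.Theorems.Transplant.KNCellsSchemeO
import Summits.CriticalPhenomena.PercolationContinuityZ3.Theorems.Transplant.KNCellsProcessO
import Summits.CriticalPhenomena.PercolationContinuityZ3.Theorems.Transplant.KNCellsRunO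
import Summits.CriticalPhenomena.PercolationContinuityZ3.Theorems.Transplant.KNCellsRunInvO
import Summits.CriticalPhenomena.PercolationContinuityZ3.Theorems.Transplant.KNCells2SchemeO
import Summits.CriticalPhenomena.PercolationContinuityZ3.Theorems.Transplant.KNCells2RunO
import Summits.CriticalPhenomena.PercolationContinuityZ3.Theorems.Transplant.KNCells2RunInvO
import Summits.CriticalPhenomena.PercolationContinuityZ3.Theorems.Transplant.KNCellsCoverO
import Summits.CriticalPhenomena.PercolationContinuityZ3.Theorems.Transplant.KNCells2CoverO
import Summits.CriticalPhenomena.PercolationContinuityZ3.Theorems.Transplant.KNCellsReachO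
import Summits.CriticalPhenomena.PercolationContinuityZ3.Theorems.Transplant.KNCells2ReachO
import Summits.CriticalPhenomena.PercolationContinuityZ3.Theorems.Transplant.KNCellsExitO
import Summits.CriticalPhenomena.PercolationContinuityZ3.Theorems.Transplant.KNCells2ThetaPos
import Literature.Probability.Percolation.OrientedHistorySiteRenormalizationRun
import Summits.CriticalPhenomena.PercolationContinuityZ3.Theorems.Transplant.KNCells2WitnessLevel
import Summits.CriticalPhenomena.PercolationContinuityZ3.Theorems.Transplant.KNCellsStepsDefsO
import Summits.CriticalPhenomena.PercolationContinuityZ3.Theorems.Transplant.KNCellsStepsChainO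
import Summits.CriticalPhenomena.PercolationContinuityZ3.Theorems.Transplant.KNCellsStepsFailO
import Summits.CriticalPhenomena.PercolationContinuityZ3.Theorems.Transplant.KNCells2StepsO
import Summits.CriticalPhenomena.PercolationContinuityZ3.Theorems.Transplant.KNCells2FailO
import Summits.CriticalPhenomena.PercolationContinuityZ3.Theorems.Transplant.KNCells2FacePrefixO
import Summits.CriticalPhenomena.PercolationContinuityZ3.Theorems.Transplant.KNCells2ThetaPosKit
import Summits.CriticalPhenomena.PercolationContinuityZ3.Theorems.Transplant.KNCells2ThetaPosChosen
import HarnessLib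

/-!
# N2 (frames-only node `SamePDropOfSkeletonFrm₁`, OPEN) — ORIENTED MACRO LAYER (WAVE 0 (c1), (R-18) `q ≡ true`): the oriented twin of N1's `KNCells2ThetaPos`

builds on p205010 (kernel theorem, internal audit signed; external expert review pending) — nothing in this file uses p205010; NOTHING is claimed about the
open node `SamePDropOfSkeletonFrm₁` (`SamePDropOfSkeletonNeg₁` is CLOSED in the tree and untouched by this file).
Status sentence (coordinator 2026-08-20T04:30Z): "θ(p_c) = 0 on ℤ^d, all d ≥ 2 — kernel-verified (Lean 4/Mathlib, standard axioms); internal adversarial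
audit SIGNED 2026-08-20 04:29Z; external expert review pending."
Lane `prim-bschramm-*`, seat `prim-bschramm-stmt` (gen 19); helper file (`--supports stmt-CriticalPhenomena-4575 --as helper`); N2-SCOPE §20, (R-18)/(R-19).
PORT RULES (HOME/prim-bschramm-stmt-g19/lean/port_orient.py): the history-site API is replaced by its ORIENTED twin at the fixed quadrant `qNE := fun _ => true`
(`HState.choice ↦ HState.ochoice qNE`, `mstOf ↦ omstOf qNE`, `mst/stN ↦ omst/ostN qNE`, `occFinal ↦ ooccFinal qNE`, `Lawful ↦ OLawful qNE`, onward directions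
`onward ↦ onwardO` = the POSITIVE ones, (N2-e)); every declaration whose text changes thereby — directly or through a changed declaration — is re-declared with the
suffix `O` (same namespace); unchanged declarations of the N1 file are NOT repeated (the N1 module is imported). Docstrings/citations are N1's.
N1 HEADER (kept for the reader):
* **`theta_pos_of_cells₂`** — `RunGeom`, `AnchGeom`, `SepGeom₂`, `ExitGeom`, `δc ≤ 1`, `ε ≤ 2⁻³²`, `0 < p`, (32) at the root (`hQ0`) and the
  failure bound after valid histories (`hfail`) ⟹ `0 < θ_{root}(p)`.  Compared with `samePWitnessAt_of_cells₂` (p215537) the degree bound `hΔ`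
  and the envelope bound `hB` are GONE: they served only Theorem A's perturbation step, which design (D) replaces by re-running the
  construction at a smaller density (`SameP.theta_pos_of_lawful`, p218990).  With growing fibre radii (anchor type `A := ℕ`-stage counter)
  the envelopes are finite per probe but not uniformly bounded — exactly what this form allows.
[cite: KozmaNitzan2024, §4 Theorem 6 (pp. 25–31), §1 p. 2 (approach 1)]
-/
noncomputable section

open MeasureTheory ProbabilityTheory
open scoped ENNReal Classical

namespace Summit.CriticalPhenomena.PercolationContinuityZ3.Theorems

namespace Transplant

namespace KNCells

open Literature.Probability.Percolation Literature.Probability.LatticeModels SimpleGraph GadgetSystem ProbeHistory HSiteScheme Contour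

variable {V : Type} [DecidableEq V] [Countable V]

namespace KSchA

variable {A : Type*} {G : SimpleGraph V} [G.LocallyFinite] {S : KSchA V A}

/-- **The anchored cells scheme forces `θ_{root}(p) > 0` — no envelope bound.** [cite: KozmaNitzan2024, §4 Theorem 6 (pp. 25–31)] -/
theorem theta_pos_of_cells₂O (hΓ : RunGeom G S.Γ) (hA : AnchGeom S.Γ) (hsep : SepGeom₂ G S.Γ) (hX : ExitGeom G S.Γ)
    (hδc : S.δc ≤ 1) {ε : ℝ} (hε : ε ≤ (1 / 2) ^ 32) (hp : 0 < (S.p : ℝ))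
    (hQ0 : ∀ du : MDir, du.2 = qNE du.1 → 1 - S.δc < (prodBernoulli (pinW (KNLevels.lattW G S.p) ↑(S.U₀ G) ↑(S.U₀ G))).real
      (⋃ t ∈ (↑(S.Γ.M S.Γ.a₀ ((0 : Site 2) + stepVec du)) : Set V),
        openConnIn (↑(S.Γ.Q S.Γ.a₀ 0 ∪ S.Γ.Ewv S.Γ.a₀ 0 du) : Set V) S.Γ.root t))
    (hfail : ∀ h e, S.Valid₂O G h e →
      (bondPercolation G S.p).real
        {ω | ¬S.succ₂O G h e (S.aOf₁O G h e) (S.aOf₂O G h e) ((S.probe₂O G h e (S.aOf₁O G h e) (S.aOf₂O G h e)).read ω)} ≤ ε) :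
    0 < theta G S.Γ.root S.p :=
  SameP.theta_pos_of_olawful (lawful₂O hΓ hA hsep hQ0 hfail) hε
    (fun x hx => (mem_edgesIn_iff.1 (Finset.mem_coe.1 hx)).1) hp
    (by
      rintro ω' ⟨hA', hinf⟩
      exact Or.inl (mem_percolatesAt_of_infinite₂O hΓ hA hX (ω := ω') hδc hA' hinf))

/-- Hence `p_c(G, root) ≤ p` for such a scheme at `p`. [cite: KozmaNitzan2024, §1 p. 2 (approach 1)] -/
theorem criticalProb_le_of_cells₂O (hΓ : RunGeom G S.Γ) (hA : AnchGeom S.Γ) (hsep : SepGeom₂ G S.Γ) (hX : ExitGeom G S.Γ)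
    (hδc : S.δc ≤ 1) {ε : ℝ} (hε : ε ≤ (1 / 2) ^ 32) (hp : 0 < (S.p : ℝ))
    (hQ0 : ∀ du : MDir, du.2 = qNE du.1 → 1 - S.δc < (prodBernoulli (pinW (KNLevels.lattW G S.p) ↑(S.U₀ G) ↑(S.U₀ G))).real
      (⋃ t ∈ (↑(S.Γ.M S.Γ.a₀ ((0 : Site 2) + stepVec du)) : Set V),
        openConnIn (↑(S.Γ.Q S.Γ.a₀ 0 ∪ S.Γ.Ewv S.Γ.a₀ 0 du) : Set V) S.Γ.root t))
    (hfail : ∀ h e, S.Valid₂O G h e →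
      (bondPercolation G S.p).real
        {ω | ¬S.succ₂O G h e (S.aOf₁O G h e) (S.aOf₂O G h e) ((S.probe₂O G h e (S.aOf₁O G h e) (S.aOf₂O G h e)).read ω)} ≤ ε) :
    criticalProb G S.Γ.root ≤ S.p :=
  OrbitQuotient.criticalProb_le_of_theta_pos G S.Γ.root S.p (theta_pos_of_cells₂O hΓ hA hsep hX hδc hε hp hQ0 hfail)

end KSchA

end KNCells

end Transplant

end Summit.CriticalPhenomena.PercolationContinuityZ3.Theorems

end

/-! ## (merged module) the oriented twin `KNCells2ThetaPosKitO` — same port rules, header as in part 1 -/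
noncomputable section

open MeasureTheory ProbabilityTheory
open scoped ENNReal Classical

namespace Summit.CriticalPhenomena.PercolationContinuityZ3.Theorems

namespace Transplant

namespace KNCells

open Literature.Probability.Percolation Literature.Probability.LatticeModels SimpleGraph GadgetSystem ProbeHistory HSiteScheme Contour

variable {V : Type} [DecidableEq V] [Countable V]

namespace KSchA

variable {A : Type*} {G : SimpleGraph V} [G.LocallyFinite] {S : KSchA V A} {FD : FaceData V A} {LD : LevelData V A}

/-- **THE NODE OVER ANCHORED CELLS, KIT FORM, NO ENVELOPE BOUND**: the hypotheses of `fail_bound₂O` after every valid history plus the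
geometry and root inputs give `θ_{root}(p) > 0`. [cite: KozmaNitzan2024, §4 Theorem 6 (pp. 25–31)] -/
theorem theta_pos_of_kit₂O (hΓ : RunGeom G S.Γ) (hA : AnchGeom S.Γ) (hsep : SepGeom₂ G S.Γ) (hX : ExitGeom G S.Γ)
    (hSt : StepsGeom S.Γ FD) (hδc : S.δc ≤ 1) {ε ε' δ₂ : ℝ} (hε : ε ≤ (1 / 2) ^ 32) (hε' : 0 ≤ ε') (hδ₂ : δ₂ ≤ 1)
    (hKε : 4 * ((1 - δ₂) ^ S.Γ.K + ε') ≤ ε) (hp : 0 < (S.p : ℝ))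
    (hQ0 : ∀ du : MDir, du.2 = qNE du.1 → 1 - S.δc < (prodBernoulli (pinW (KNLevels.lattW G S.p) ↑(S.U₀ G) ↑(S.U₀ G))).real
      (⋃ t ∈ (↑(S.Γ.M S.Γ.a₀ ((0 : Site 2) + stepVec du)) : Set V),
        openConnIn (↑(S.Γ.Q S.Γ.a₀ 0 ∪ S.Γ.Ewv S.Γ.a₀ 0 du) : Set V) S.Γ.root t))
    (hP1 : ∀ h e, S.Valid₂O G h e → ∀ du ∈ S.onwardO G h (tgt e), ∀ ω,
      ω ∈ KNLevels.lattOnly G (S.Vx G h ∪ S.Γ.Ewv (S.aOf₁O G h e) e.1 e.2 ∪ FD.Hfull (S.aOf₂O G h e) (tgt e) du) →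
      ω ∈ S.Reach G FD h e (S.aOf₁O G h e) (S.aOf₂O G h e) du → ω ∈ S.Aface G FD h e (S.aOf₁O G h e) (S.aOf₂O G h e) du (S.Γ.K - 1))
    (hP2 : ∀ h e, S.Valid₂O G h e → ∀ du ∈ S.onwardO G h (tgt e), ∀ ω j, 1 ≤ j → j < S.Γ.K →
      ω ∈ KNLevels.lattOnly G (S.Vx G h ∪ S.Γ.Ewv (S.aOf₁O G h e) e.1 e.2 ∪ S.Γ.Stub (S.aOf₂O G h e) (tgt e) du (j + 1)) →
      ω ∈ S.Aface G FD h e (S.aOf₁O G h e) (S.aOf₂O G h e) du j → ω ∈ S.Aface G FD h e (S.aOf₁O G h e) (S.aOf₂O G h e) du (j - 1))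
    (hface : ∀ h e, S.Valid₂O G h e → ∀ du ∈ S.onwardO G h (tgt e), ∀ j < S.Γ.K, ∀ o : Finset (Sym2 V),
      1 - δ₂ < (prodBernoulli (S.Wt G h e (S.aOf₁O G h e) (S.aOf₂O G h e) du j o)).real
        (⋃ b ∈ FD.Face (S.aOf₂O G h e) (tgt e) du (j + 1), openConn S.Γ.root b) →
        S.cond G h e (S.aOf₁O G h e) (S.aOf₂O G h e) du j o)
    (hreach : ∀ h e, S.Valid₂O G h e → ∀ du ∈ S.onwardO G h (tgt e),
      1 - ε' < (prodBernoulli (S.Wfull G h e (S.aOf₁O G h e) (S.aOf₂O G h e) du)).real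
        (S.Reach G FD h e (S.aOf₁O G h e) (S.aOf₂O G h e) du)) :
    0 < theta G S.Γ.root S.p := by
  refine theta_pos_of_cells₂O hΓ hA hsep hX hδc hε hp hQ0 fun h e hV => ?_
  exact (fail_bound₂O hV.anch hV hSt hε' hδ₂ (hP1 h e hV) (hP2 h e hV) (hface h e hV) (hreach h e hV)).trans hKε

/-- **THE NODE OVER ANCHORED CELLS, KIT FORM with a level geometry, NO ENVELOPE BOUND**: as `theta_pos_of_kit₂O` with the face-prefix inputs
discharged by `LevelGeom`. [cite: KozmaNitzan2024, §4 Theorem 6 (pp. 25–31)] -/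
theorem theta_pos_of_kit₂'O (hΓ : RunGeom G S.Γ) (hA : AnchGeom S.Γ) (hsep : SepGeom₂ G S.Γ) (hX : ExitGeom G S.Γ)
    (hSt : StepsGeom S.Γ FD) (hL : LevelGeom G S.Γ FD LD) (hδc : S.δc ≤ 1) {ε ε' δ₂ : ℝ} (hε : ε ≤ (1 / 2) ^ 32) (hε' : 0 ≤ ε')
    (hδ₂ : δ₂ ≤ 1) (hKε : 4 * ((1 - δ₂) ^ S.Γ.K + ε') ≤ ε) (hp : 0 < (S.p : ℝ))
    (hQ0 : ∀ du : MDir, du.2 = qNE du.1 → 1 - S.δc < (prodBernoulli (pinW (KNLevels.lattW G S.p) ↑(S.U₀ G) ↑(S.U₀ G))).real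
      (⋃ t ∈ (↑(S.Γ.M S.Γ.a₀ ((0 : Site 2) + stepVec du)) : Set V),
        openConnIn (↑(S.Γ.Q S.Γ.a₀ 0 ∪ S.Γ.Ewv S.Γ.a₀ 0 du) : Set V) S.Γ.root t))
    (hface : ∀ h e, S.Valid₂O G h e → ∀ du ∈ S.onwardO G h (tgt e), ∀ j < S.Γ.K, ∀ o : Finset (Sym2 V),
      1 - δ₂ < (prodBernoulli (S.Wt G h e (S.aOf₁O G h e) (S.aOf₂O G h e) du j o)).real
        (⋃ b ∈ FD.Face (S.aOf₂O G h e) (tgt e) du (j + 1), openConn S.Γ.root b) →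
        S.cond G h e (S.aOf₁O G h e) (S.aOf₂O G h e) du j o)
    (hreach : ∀ h e, S.Valid₂O G h e → ∀ du ∈ S.onwardO G h (tgt e),
      1 - ε' < (prodBernoulli (S.Wfull G h e (S.aOf₁O G h e) (S.aOf₂O G h e) du)).real
        (S.Reach G FD h e (S.aOf₁O G h e) (S.aOf₂O G h e) du)) :
    0 < theta G S.Γ.root S.p :=
  theta_pos_of_kit₂O hΓ hA hsep hX hSt hδc hε hε' hδ₂ hKε hp hQ0 (fun _ _ hV => facePrefix₂_P1O hL hV)
    (fun _ _ hV => facePrefix₂_P2O hL hSt hV) hface hreach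

/-- Hence `p_c(G, root) ≤ p` for such a kit at `p`. [cite: KozmaNitzan2024, §1 p. 2 (approach 1)] -/
theorem criticalProb_le_of_kit₂'O (hΓ : RunGeom G S.Γ) (hA : AnchGeom S.Γ) (hsep : SepGeom₂ G S.Γ) (hX : ExitGeom G S.Γ)
    (hSt : StepsGeom S.Γ FD) (hL : LevelGeom G S.Γ FD LD) (hδc : S.δc ≤ 1) {ε ε' δ₂ : ℝ} (hε : ε ≤ (1 / 2) ^ 32) (hε' : 0 ≤ ε')
    (hδ₂ : δ₂ ≤ 1) (hKε : 4 * ((1 - δ₂) ^ S.Γ.K + ε') ≤ ε) (hp : 0 < (S.p : ℝ))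
    (hQ0 : ∀ du : MDir, du.2 = qNE du.1 → 1 - S.δc < (prodBernoulli (pinW (KNLevels.lattW G S.p) ↑(S.U₀ G) ↑(S.U₀ G))).real
      (⋃ t ∈ (↑(S.Γ.M S.Γ.a₀ ((0 : Site 2) + stepVec du)) : Set V),
        openConnIn (↑(S.Γ.Q S.Γ.a₀ 0 ∪ S.Γ.Ewv S.Γ.a₀ 0 du) : Set V) S.Γ.root t))
    (hface : ∀ h e, S.Valid₂O G h e → ∀ du ∈ S.onwardO G h (tgt e), ∀ j < S.Γ.K, ∀ o : Finset (Sym2 V),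
      1 - δ₂ < (prodBernoulli (S.Wt G h e (S.aOf₁O G h e) (S.aOf₂O G h e) du j o)).real
        (⋃ b ∈ FD.Face (S.aOf₂O G h e) (tgt e) du (j + 1), openConn S.Γ.root b) →
        S.cond G h e (S.aOf₁O G h e) (S.aOf₂O G h e) du j o)
    (hreach : ∀ h e, S.Valid₂O G h e → ∀ du ∈ S.onwardO G h (tgt e),
      1 - ε' < (prodBernoulli (S.Wfull G h e (S.aOf₁O G h e) (S.aOf₂O G h e) du)).real
        (S.Reach G FD h e (S.aOf₁O G h e) (S.aOf₂O G h e) du)) :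
    criticalProb G S.Γ.root ≤ S.p :=
  OrbitQuotient.criticalProb_le_of_theta_pos G S.Γ.root S.p
    (theta_pos_of_kit₂'O hΓ hA hsep hX hSt hL hδc hε hε' hδ₂ hKε hp hQ0 hface hreach)

end KSchA

end KNCells

end Transplant

end Summit.CriticalPhenomena.PercolationContinuityZ3.Theorems

end

/-! ## (merged module) the oriented twin `KNCells2ThetaPosChosenO` — same port rules, header as in part 1 -/
noncomputable section

open MeasureTheory ProbabilityTheory
open scoped ENNReal Classical

namespace Summit.CriticalPhenomena.PercolationContinuityZ3.Theorems

namespace Transplant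

namespace KNCells

open Literature.Probability.Percolation Literature.Probability.LatticeModels SimpleGraph GadgetSystem ProbeHistory HSiteScheme Contour

namespace KSchA

section Replay

variable {V : Type*} [DecidableEq V] {A : Type*} {G : SimpleGraph V} [G.LocallyFinite] {S : KSchA V A}

/-- **Replay invariant of the anchors.**  After any history, every macro-vertex either carries both anchors `a₀` and is occupied only if
it is the root, or its stub anchor is the re-centring rule applied to its region anchor (it was a target of a replayed probe). [folklore] -/
theorem anchors_replayO (h : ProbeHistory V) (v : Site 2) :
    (∃ P : Finset (Sym2 V), (S.astOf₂O G h).dep v = S.Γ.anchor ((S.astOf₂O G h).arr v) v P) ∨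
      ((S.astOf₂O G h).arr v = S.Γ.a₀ ∧ (S.astOf₂O G h).dep v = S.Γ.a₀ ∧ (v ∈ (S.astOf₂O G h).st.occ → v = 0)) := by
  induction h generalizing v with
  | nil =>
    right
    refine ⟨rfl, rfl, fun hv => ?_⟩
    simpa [astOf₂_nilO, HState.start] using hv
  | cons r h ih =>
    cases r with
    | none => simpa only [astOf₂_cons_noneO] using ih v
    | some r =>
      rw [astOf₂_cons_someO]
      cases hc : (S.astOf₂O G h).st.ochoice qNE with
      | none => exact ih v
      | some e =>
        dsimp only
        by_cases hv : v = tgt e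
        · subst hv
          left
          refine ⟨S.seen G h e ((S.astOf₂O G h).arr e.1) r.2, ?_⟩
          simp only [Function.update_self, depB]
        · rcases ih v with ⟨P, hP⟩ | ⟨h1, h2, h3⟩
          · left
            exact ⟨P, by simp only [Function.update_of_ne hv]; exact hP⟩
          · right
            refine ⟨by simp only [Function.update_of_ne hv]; exact h1, by simp only [Function.update_of_ne hv]; exact h2, fun hocc => ?_⟩
            have hocc' : v ∈ insert (tgt e) (S.astOf₂O G h).st.occ := HState.occ_update_subset _ _ _ hocc
            rcases Finset.mem_insert.1 hocc' with h' | h'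
            · exact absurd h' hv
            · exact h3 h'

/-- **Anchors of a CHOSEN edge**: the source of the scheme's chosen edge is occupied, hence either it is the root and the probe runs with both
anchors `a₀`, or its stub anchor is the re-centring rule applied to its region anchor. [folklore] -/
theorem anchors_of_choiceO (h : ProbeHistory V) {e : Site 2 × MDir} (hc : (S.astOf₂O G h).st.ochoice qNE = some e) :
    (∃ P : Finset (Sym2 V), S.aOf₂O G h e = S.Γ.anchor (S.aOf₁O G h e) e.1 P) ∨
      (e.1 = 0 ∧ S.aOf₁O G h e = S.Γ.a₀ ∧ S.aOf₂O G h e = S.Γ.a₀) := by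
  rcases anchors_replayO (S := S) (G := G) h e.1 with ⟨P, hP⟩ | ⟨h1, h2, h3⟩
  · exact Or.inl ⟨P, hP⟩
  · exact Or.inr ⟨h3 (HState.cand_of_ochoice hc).1, h1, h2⟩

end Replay

section Node

variable {V : Type} [DecidableEq V] [Countable V]
variable {A : Type*} {G : SimpleGraph V} [G.LocallyFinite] {S : KSchA V A} {FD : FaceData V A} {LD : LevelData V A}

/-- **`scheme₂O` is lawful from the failure bound at CHOSEN edges only** (proof = p2-g2's `lawful₂O`, which already had the choice in hand).
[cite: KozmaNitzan2024, §4 pp. 25–31] -/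
theorem lawful₂_chosenO (hΓ : RunGeom G S.Γ) (hA : AnchGeom S.Γ) (hsep : SepGeom₂ G S.Γ) {ε : ℝ}
    (hQ0 : ∀ du : MDir, du.2 = qNE du.1 → 1 - S.δc < (prodBernoulli (pinW (KNLevels.lattW G S.p) ↑(S.U₀ G) ↑(S.U₀ G))).real
      (⋃ t ∈ (↑(S.Γ.M S.Γ.a₀ ((0 : Site 2) + stepVec du)) : Set V),
        openConnIn (↑(S.Γ.Q S.Γ.a₀ 0 ∪ S.Γ.Ewv S.Γ.a₀ 0 du) : Set V) S.Γ.root t))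
    (hfail : ∀ h e, (S.astOf₂O G h).st.ochoice qNE = some e → S.Valid₂O G h e →
      (bondPercolation G S.p).real
        {ω | ¬S.succ₂O G h e (S.aOf₁O G h e) (S.aOf₂O G h e) ((S.probe₂O G h e (S.aOf₁O G h e) (S.aOf₂O G h e)).read ω)} ≤ ε) :
    (S.scheme₂O G).OLawful qNE G S.p ε where
  fresh := by
    intro h P hP
    obtain ⟨e, -, -, rfl⟩ := S.nextProbe₂_eq_someO hP
    constructor
    · rw [Set.disjoint_left]
      intro x hx hxU
      exact (Finset.mem_sdiff.1 (Finset.mem_coe.1 hx)).2 (S.U₀_subset_F _ (Finset.mem_coe.1 hxU))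
    · rw [Finset.disjoint_left]
      intro x hx hxs
      exact (Finset.mem_sdiff.1 hx).2 (Finset.mem_union_right _ hxs)
  probes := by
    intro ω _ n hc
    obtain ⟨e, he⟩ := Option.ne_none_iff_exists'.1 hc
    have hV : S.Valid₂O G (S.hst₂O G ω n) e := valid_of_choice₂O hΓ hA hsep hQ0 he
    have he' : (S.astOf₂O G (S.hst₂O G ω n)).st.ochoice qNE = some e := by rw [← S.stN_eq₂O]; exact he
    show S.nextProbe₂O G (S.hst₂O G ω n) ≠ none
    rw [S.nextProbe₂_of_validO he' hV]
    exact Option.some_ne_none _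
  fail := by
    intro h P e hP hc
    obtain ⟨e', hc', hV, rfl⟩ := S.nextProbe₂_eq_someO hP
    have hc'' : (S.astOf₂O G h).st.ochoice qNE = some e := by rw [← S.scheme₂_mstO]; exact hc
    have hcc : some e' = some e := hc'.symm.trans hc''
    cases Option.some_injective _ hcc
    exact hfail h _ hc'' hV

/-- **The anchored cells scheme forces `θ_{root}(p) > 0` — failure bound at CHOSEN edges, no envelope bound** (proof = the lead's
`theta_pos_of_cells₂O` with `lawful₂_chosenO`). [cite: KozmaNitzan2024, §4 Theorem 6 (pp. 25–31)] -/
theorem theta_pos_of_cells₂_chosenO (hΓ : RunGeom G S.Γ) (hA : AnchGeom S.Γ) (hsep : SepGeom₂ G S.Γ) (hX : ExitGeom G S.Γ)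
    (hδc : S.δc ≤ 1) {ε : ℝ} (hε : ε ≤ (1 / 2) ^ 32) (hp : 0 < (S.p : ℝ))
    (hQ0 : ∀ du : MDir, du.2 = qNE du.1 → 1 - S.δc < (prodBernoulli (pinW (KNLevels.lattW G S.p) ↑(S.U₀ G) ↑(S.U₀ G))).real
      (⋃ t ∈ (↑(S.Γ.M S.Γ.a₀ ((0 : Site 2) + stepVec du)) : Set V),
        openConnIn (↑(S.Γ.Q S.Γ.a₀ 0 ∪ S.Γ.Ewv S.Γ.a₀ 0 du) : Set V) S.Γ.root t))
    (hfail : ∀ h e, (S.astOf₂O G h).st.ochoice qNE = some e → S.Valid₂O G h e →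
      (bondPercolation G S.p).real
        {ω | ¬S.succ₂O G h e (S.aOf₁O G h e) (S.aOf₂O G h e) ((S.probe₂O G h e (S.aOf₁O G h e) (S.aOf₂O G h e)).read ω)} ≤ ε) :
    0 < theta G S.Γ.root S.p :=
  SameP.theta_pos_of_olawful (lawful₂_chosenO hΓ hA hsep hQ0 hfail) hε
    (fun x hx => (mem_edgesIn_iff.1 (Finset.mem_coe.1 hx)).1) hp
    (by
      rintro ω' ⟨hA', hinf⟩
      exact Or.inl (mem_percolatesAt_of_infinite₂O hΓ hA hX (ω := ω') hδc hA' hinf))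

/-- **THE NODE OVER ANCHORED CELLS, KIT FORM, obligations at CHOSEN edges**: as `theta_pos_of_kit₂O` with `hface` / `hreach` asked only
after valid histories AT THE EDGE THE SCHEME CHOOSES. [cite: KozmaNitzan2024, §4 Theorem 6 (pp. 25–31)] -/
theorem theta_pos_of_kit₂_chosenO (hΓ : RunGeom G S.Γ) (hA : AnchGeom S.Γ) (hsep : SepGeom₂ G S.Γ) (hX : ExitGeom G S.Γ)
    (hSt : StepsGeom S.Γ FD) (hδc : S.δc ≤ 1) {ε ε' δ₂ : ℝ} (hε : ε ≤ (1 / 2) ^ 32) (hε' : 0 ≤ ε') (hδ₂ : δ₂ ≤ 1)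
    (hKε : 4 * ((1 - δ₂) ^ S.Γ.K + ε') ≤ ε) (hp : 0 < (S.p : ℝ))
    (hQ0 : ∀ du : MDir, du.2 = qNE du.1 → 1 - S.δc < (prodBernoulli (pinW (KNLevels.lattW G S.p) ↑(S.U₀ G) ↑(S.U₀ G))).real
      (⋃ t ∈ (↑(S.Γ.M S.Γ.a₀ ((0 : Site 2) + stepVec du)) : Set V),
        openConnIn (↑(S.Γ.Q S.Γ.a₀ 0 ∪ S.Γ.Ewv S.Γ.a₀ 0 du) : Set V) S.Γ.root t))
    (hP1 : ∀ h e, S.Valid₂O G h e → ∀ du ∈ S.onwardO G h (tgt e), ∀ ω,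
      ω ∈ KNLevels.lattOnly G (S.Vx G h ∪ S.Γ.Ewv (S.aOf₁O G h e) e.1 e.2 ∪ FD.Hfull (S.aOf₂O G h e) (tgt e) du) →
      ω ∈ S.Reach G FD h e (S.aOf₁O G h e) (S.aOf₂O G h e) du → ω ∈ S.Aface G FD h e (S.aOf₁O G h e) (S.aOf₂O G h e) du (S.Γ.K - 1))
    (hP2 : ∀ h e, S.Valid₂O G h e → ∀ du ∈ S.onwardO G h (tgt e), ∀ ω j, 1 ≤ j → j < S.Γ.K →
      ω ∈ KNLevels.lattOnly G (S.Vx G h ∪ S.Γ.Ewv (S.aOf₁O G h e) e.1 e.2 ∪ S.Γ.Stub (S.aOf₂O G h e) (tgt e) du (j + 1)) →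
      ω ∈ S.Aface G FD h e (S.aOf₁O G h e) (S.aOf₂O G h e) du j → ω ∈ S.Aface G FD h e (S.aOf₁O G h e) (S.aOf₂O G h e) du (j - 1))
    (hface : ∀ h e, (S.astOf₂O G h).st.ochoice qNE = some e → S.Valid₂O G h e → ∀ du ∈ S.onwardO G h (tgt e), ∀ j < S.Γ.K,
      ∀ o : Finset (Sym2 V),
      1 - δ₂ < (prodBernoulli (S.Wt G h e (S.aOf₁O G h e) (S.aOf₂O G h e) du j o)).real
        (⋃ b ∈ FD.Face (S.aOf₂O G h e) (tgt e) du (j + 1), openConn S.Γ.root b) →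
        S.cond G h e (S.aOf₁O G h e) (S.aOf₂O G h e) du j o)
    (hreach : ∀ h e, (S.astOf₂O G h).st.ochoice qNE = some e → S.Valid₂O G h e → ∀ du ∈ S.onwardO G h (tgt e),
      1 - ε' < (prodBernoulli (S.Wfull G h e (S.aOf₁O G h e) (S.aOf₂O G h e) du)).real
        (S.Reach G FD h e (S.aOf₁O G h e) (S.aOf₂O G h e) du)) :
    0 < theta G S.Γ.root S.p := by
  refine theta_pos_of_cells₂_chosenO hΓ hA hsep hX hδc hε hp hQ0 fun h e hc hV => ?_
  exact (fail_bound₂O hV.anch hV hSt hε' hδ₂ (hP1 h e hV) (hP2 h e hV) (hface h e hc hV) (hreach h e hc hV)).trans hKε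

/-- **THE NODE, kit form with a level geometry, obligations at CHOSEN edges** (face-prefix inputs from `LevelGeom`).
[cite: KozmaNitzan2024, §4 Theorem 6 (pp. 25–31)] -/
theorem theta_pos_of_kit₂_chosen'O (hΓ : RunGeom G S.Γ) (hA : AnchGeom S.Γ) (hsep : SepGeom₂ G S.Γ) (hX : ExitGeom G S.Γ)
    (hSt : StepsGeom S.Γ FD) (hL : LevelGeom G S.Γ FD LD) (hδc : S.δc ≤ 1) {ε ε' δ₂ : ℝ} (hε : ε ≤ (1 / 2) ^ 32) (hε' : 0 ≤ ε')
    (hδ₂ : δ₂ ≤ 1) (hKε : 4 * ((1 - δ₂) ^ S.Γ.K + ε') ≤ ε) (hp : 0 < (S.p : ℝ))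
    (hQ0 : ∀ du : MDir, du.2 = qNE du.1 → 1 - S.δc < (prodBernoulli (pinW (KNLevels.lattW G S.p) ↑(S.U₀ G) ↑(S.U₀ G))).real
      (⋃ t ∈ (↑(S.Γ.M S.Γ.a₀ ((0 : Site 2) + stepVec du)) : Set V),
        openConnIn (↑(S.Γ.Q S.Γ.a₀ 0 ∪ S.Γ.Ewv S.Γ.a₀ 0 du) : Set V) S.Γ.root t))
    (hface : ∀ h e, (S.astOf₂O G h).st.ochoice qNE = some e → S.Valid₂O G h e → ∀ du ∈ S.onwardO G h (tgt e), ∀ j < S.Γ.K,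
      ∀ o : Finset (Sym2 V),
      1 - δ₂ < (prodBernoulli (S.Wt G h e (S.aOf₁O G h e) (S.aOf₂O G h e) du j o)).real
        (⋃ b ∈ FD.Face (S.aOf₂O G h e) (tgt e) du (j + 1), openConn S.Γ.root b) →
        S.cond G h e (S.aOf₁O G h e) (S.aOf₂O G h e) du j o)
    (hreach : ∀ h e, (S.astOf₂O G h).st.ochoice qNE = some e → S.Valid₂O G h e → ∀ du ∈ S.onwardO G h (tgt e),
      1 - ε' < (prodBernoulli (S.Wfull G h e (S.aOf₁O G h e) (S.aOf₂O G h e) du)).real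
        (S.Reach G FD h e (S.aOf₁O G h e) (S.aOf₂O G h e) du)) :
    0 < theta G S.Γ.root S.p :=
  theta_pos_of_kit₂_chosenO hΓ hA hsep hX hSt hδc hε hε' hδ₂ hKε hp hQ0 (fun _ _ hV => facePrefix₂_P1O hL hV)
    (fun _ _ hV => facePrefix₂_P2O hL hSt hV) hface hreach

end Node

end KSchA

end KNCells

end Transplant

end Summit.CriticalPhenomena.PercolationContinuityZ3.Theorems

end
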